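import Mathlib
import Summits.Parity.BatemanHorn.Theorems.IsogenyRedeiTypeIMainTermComponents
import HarnessLib

/-!
# Type-I main term for Bateman–Horn (stmt-Parity-0873), input B5 (part 1):
# the pure part `𝓮₀ = [ε_∅] 𝓮` and its Euler factors

* `proj0` — the ring homomorphism `[ε_∅] : Λ_k → ℝ` applied to `Λ_k`-valued arithmetic functions
  commutes with Dirichlet products (`proj0_mul`); `proj0 (psiFun f i) = gcmAF f i`,
  `proj0 (eFun f) = compE f univ`;
* `tsum_mul_prime_pow` — **local Cauchy product**: `∑_v (F ⋆ G)(p^v) = (∑_j F(p^j))(∑_j G(p^j))`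
  for absolutely convergent local series;
* `tsum_prod_gcmAF_prime_pow` — `∑_v (∏_i gcm_i)(p^v) = ∏_i (1 − g_i(p))⁻¹`;
* `tsum_compE_univ_prime_pow` — **the Euler factor of `𝓮₀`**:
  `∑_v 𝓮₀(p^v) = (∑_{j ≤ k} 𝒶₀(p^j)) · ∏_i (1 − g_i(p))⁻¹`.

Everything here is proved.
-/

noncomputable section

open Finset Polynomial ArithmeticFunction Filter Topology
open scoped ArithmeticFunction.Moebius

namespace Summit.Parity.BatemanHorn.Theorems.TypeIMainTerm

open Literature.NumberTheory.Sieve Literature.NumberTheory.LFunctions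

variable {k : ℕ} (f : Fin k → ℤ[X])

/-! ### The pure part as a homomorphism -/

/-- `proj0 (F * G) = proj0 F * proj0 G`. -/
theorem proj0_mul (F G : ArithmeticFunction (SAlg k)) : proj0 (F * G) = proj0 F * proj0 G := by
  ext n
  rw [proj0_apply, ArithmeticFunction.mul_apply, ArithmeticFunction.mul_apply, SAlg.coeff_finset_sum]
  exact Finset.sum_congr rfl fun x _ => by rw [SAlg.coeff_empty_mul, proj0_apply, proj0_apply]

/-- `proj0 (1 : ArithmeticFunction (SAlg k)) = 1`. -/
theorem proj0_one : proj0 (1 : ArithmeticFunction (SAlg k)) = 1 := by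
  ext n
  rw [proj0_apply, ArithmeticFunction.one_apply, ArithmeticFunction.one_apply]
  split_ifs
  · exact SAlg.coeff_empty_one
  · exact SAlg.coeff_zero _

/-- `proj0 (∏ i ∈ s, F i) = ∏ i ∈ s, proj0 (F i)`. -/
theorem proj0_prod {ι : Type*} (s : Finset ι) (F : ι → ArithmeticFunction (SAlg k)) :
    proj0 (∏ i ∈ s, F i) = ∏ i ∈ s, proj0 (F i) := by
  classical
  induction s using Finset.induction_on with
  | empty => simp [proj0_one]
  | insert a s ha ih => rw [Finset.prod_insert ha, Finset.prod_insert ha, proj0_mul, ih]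

/-- `proj0 (psiFun f i) = gcmAF f i`. -/
theorem proj0_psiFun (i : Fin k) : proj0 (psiFun f i) = gcmAF f i := by
  ext n; rw [proj0_apply, psiFun_apply, SAlg.coeff_smul, SAlg.coeff_lin_empty, mul_one, gcmAF_apply]

/-- `proj0 (eFun f) = compE f Finset.univ`. -/
theorem proj0_eFun : proj0 (eFun f) = compE f Finset.univ := by
  ext n; rw [proj0_apply, compE_apply, Finset.sdiff_self]

/-- `proj0 (eFun f) = proj0 (aFun f) * ∏ i, gcmAF f i`. -/
theorem proj0_eFun_eq : proj0 (eFun f) = proj0 (aFun f) * ∏ i, gcmAF f i := by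
  rw [eFun, proj0_mul, proj0_prod]
  congr 1
  exact Finset.prod_congr rfl fun i _ => proj0_psiFun f i

/-! ### Local Cauchy products -/

/-- **Local Cauchy product**: `∑_v (F ⋆ G)(p^v) = (∑_j F(p^j)) · (∑_j G(p^j))`. -/
theorem tsum_mul_prime_pow (F G : ArithmeticFunction ℝ) {p : ℕ} (hp : p.Prime)
    (hF : Summable fun j => ‖F (p ^ j)‖) (hG : Summable fun j => ‖G (p ^ j)‖) :
    Summable (fun v => ‖(F * G) (p ^ v)‖) ∧
      ∑' v, (F * G) (p ^ v) = (∑' j, F (p ^ j)) * ∑' j, G (p ^ j) := by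
  have key : ∀ v : ℕ, (F * G) (p ^ v) =
      ∑ kl ∈ antidiagonal v, F (p ^ kl.1) * G (p ^ kl.2) := by
    intro v
    rw [mul_apply_prime_pow _ _ hp, Finset.Nat.sum_antidiagonal_eq_sum_range_succ
      (fun i j => F (p ^ i) * G (p ^ j))]
  have h1 := summable_norm_sum_mul_antidiagonal_of_summable_norm
    (f := fun j => F (p ^ j)) (g := fun j => G (p ^ j)) hF hG
  have h2 := tsum_mul_tsum_eq_tsum_sum_antidiagonal_of_summable_norm
    (f := fun j => F (p ^ j)) (g := fun j => G (p ^ j)) hF hG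
  refine ⟨h1.congr fun v => by rw [key], ?_⟩
  rw [h2]
  exact tsum_congr fun v => key v

/-- The local series of `1`. -/
theorem tsum_one_prime_pow {p : ℕ} (hp : p.Prime) :
    Summable (fun v => ‖(1 : ArithmeticFunction ℝ) (p ^ v)‖) ∧
      ∑' v, (1 : ArithmeticFunction ℝ) (p ^ v) = 1 := by
  have hv : ∀ v : ℕ, (1 : ArithmeticFunction ℝ) (p ^ v) = if v = 0 then 1 else 0 := by
    intro v
    rw [ArithmeticFunction.one_apply]
    rcases Nat.eq_zero_or_pos v with rfl | hv
    · simp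
    · rw [if_neg (Nat.one_lt_pow hv.ne' hp.one_lt).ne', if_neg hv.ne']
  simp_rw [hv]
  refine ⟨summable_of_ne_finset_zero (s := {0}) fun v hv => by
    rw [Finset.mem_singleton] at hv; simp [hv], ?_⟩
  rw [tsum_eq_single 0 fun v hv => by simp [hv]]
  simp

/-- The local series of `gcm_i`: `∑_v g_i(p)^v = (1 − g_i(p))⁻¹`. -/
theorem tsum_gcmAF_prime_pow (i : Fin k) {p : ℕ} (hp : p.Prime)
    (hρ : polyRootCountMod ![f i] p < p) :
    Summable (fun v => ‖gcmAF f i (p ^ v)‖) ∧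
      ∑' v, gcmAF f i (p ^ v) = (1 - rootDensity (f i) p)⁻¹ := by
  have hg0 : 0 ≤ rootDensity (f i) p := rootDensity_nonneg _ _
  have hg1 : rootDensity (f i) p < 1 := by
    have hp0 : (0 : ℝ) < p := by exact_mod_cast hp.pos
    rw [rootDensity_apply, div_lt_one hp0]; exact_mod_cast hρ
  simp_rw [gcmAF_apply, gcm_prime_pow f i hp]
  refine ⟨?_, tsum_geometric_of_lt_one hg0 hg1⟩
  simp_rw [Real.norm_eq_abs, abs_pow, abs_of_nonneg hg0]
  exact summable_geometric_of_lt_one hg0 hg1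

/-- `∑_v (∏_i gcm_i)(p^v) = ∏_i (1 − g_i(p))⁻¹`. -/
theorem tsum_prod_gcmAF_prime_pow {p : ℕ} (hp : p.Prime)
    (hρ : ∀ i, polyRootCountMod ![f i] p < p) (s : Finset (Fin k)) :
    Summable (fun v => ‖(∏ i ∈ s, gcmAF f i) (p ^ v)‖) ∧
      ∑' v, (∏ i ∈ s, gcmAF f i) (p ^ v) = ∏ i ∈ s, (1 - rootDensity (f i) p)⁻¹ := by
  classical
  induction s using Finset.induction_on with
  | empty => simpa using tsum_one_prime_pow hp
  | insert a s ha ih =>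
    rw [Finset.prod_insert ha, Finset.prod_insert ha]
    obtain ⟨h1, h2⟩ := tsum_gcmAF_prime_pow f a hp (hρ a)
    obtain ⟨h3, h4⟩ := tsum_mul_prime_pow _ _ hp h1 ih.1
    exact ⟨h3, by rw [h4, h2, ih.2]⟩

/-- The local series of `𝒶₀` is a finite sum. -/
theorem tsum_proj0_aFun_prime_pow {p : ℕ} (hp : p.Prime) :
    Summable (fun v => ‖proj0 (aFun f) (p ^ v)‖) ∧
      ∑' v, proj0 (aFun f) (p ^ v) = ∑ j ∈ Finset.range (k + 1), proj0 (aFun f) (p ^ j) := by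
  have hz : ∀ v, v ∉ Finset.range (k + 1) → proj0 (aFun f) (p ^ v) = 0 := by
    intro v hv
    rw [Finset.mem_range, not_lt] at hv
    rw [proj0_apply, aFun_prime_pow_eq_zero_of_lt f hp (by omega), SAlg.coeff_zero]
  exact ⟨summable_of_ne_finset_zero fun v hv => by rw [hz v hv, norm_zero], tsum_eq_sum hz⟩

/-- **The Euler factor of `𝓮₀`**: `∑_v 𝓮₀(p^v) = (∑_{j ≤ k} 𝒶₀(p^j)) ∏_i (1 − g_i(p))⁻¹`. -/
theorem tsum_compE_univ_prime_pow {p : ℕ} (hp : p.Prime) (hρ : ∀ i, polyRootCountMod ![f i] p < p) :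
    ∑' v, compE f Finset.univ (p ^ v) =
      (∑ j ∈ Finset.range (k + 1), proj0 (aFun f) (p ^ j)) * ∏ i, (1 - rootDensity (f i) p)⁻¹ := by
  rw [← proj0_eFun, proj0_eFun_eq]
  obtain ⟨h1, h2⟩ := tsum_proj0_aFun_prime_pow f hp
  obtain ⟨h3, h4⟩ := tsum_prod_gcmAF_prime_pow f hp hρ Finset.univ
  rw [(tsum_mul_prime_pow _ _ hp h1 h3).2, h2, h4]

end Summit.Parity.BatemanHorn.Theorems.TypeIMainTerm

end

/-!
# Type-I main term for Bateman–Horn (stmt-Parity-0873), input B5 (part 2):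
# inclusion–exclusion at a prime and the identification of the constant

* `sum_proj0_aFun_prime_pow` — **`∑_{j ≤ k} 𝒶₀(p^j) = 1 − ω(p)/p`**: the square-free tuples of
  powers of `p` are the `p^{𝟙_S}`, `S ⊆ [k]`, `𝒶₀` only sees those, `G(p^{𝟙_S}) p` counts the
  `n mod p` with `p ∣ f_i(n)` for all `i ∈ S`, and `∑_{S ⊆ Z(n)} (−1)^{|S|} = [Z(n) = ∅]`;
* `tsum_compE_univ_mul_prod_const` — for a Bateman–Horn system,
  **`(∑_n 𝓮₀(n)) · ∏_i C(f_i) = C(f)`** (Euler product of `𝓮₀`,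
  `ArithmeticFunction.IsMultiplicative.eulerProduct`, against the ordered partial products
  `HasBatemanHornConst` of the `f_i` and of `f`), with `C(f) > 0`.

Everything here is proved.
-/

noncomputable section

open Finset Polynomial ArithmeticFunction Filter Topology
open scoped ArithmeticFunction.Moebius

namespace Summit.Parity.BatemanHorn.Theorems.TypeIMainTerm

open Literature.NumberTheory.Sieve Literature.NumberTheory.LFunctions

variable {k : ℕ} (f : Fin k → ℤ[X])

/-! ### The tuples `p^{𝟙_S}` -/

/-- `∏ i, dS p S i = p ^ S.card`. -/
theorem prod_dS {p : ℕ} (S : Finset (Fin k)) : ∏ i, dS p S i = p ^ S.card := by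
  classical
  simp only [dS_apply]
  rw [Finset.prod_ite, Finset.prod_const_one, mul_one, Finset.prod_const, Finset.filter_mem_eq_inter,
    Finset.univ_inter]

/-- `dS p S ∈ Nat.finMulAntidiag k (p ^ S.card)`. -/
theorem dS_mem_finMulAntidiag {p : ℕ} (hp : p.Prime) (S : Finset (Fin k)) :
    dS p S ∈ Nat.finMulAntidiag k (p ^ S.card) := by
  rw [Nat.mem_finMulAntidiag]; exact ⟨prod_dS S, pow_ne_zero _ hp.ne_zero⟩

/-- `S ↦ dS p S` is injective for a prime `p`. -/
theorem dS_injective {p : ℕ} (hp : p.Prime) : Function.Injective (dS (k := k) p) := by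
  intro S T h
  ext i
  have hi := congr_fun h i
  simp only [dS_apply] at hi
  by_cases hS : i ∈ S <;> by_cases hT : i ∈ T <;> simp only [hS, hT, if_true, if_false] at hi
  · tauto
  · exact absurd hi hp.one_lt.ne'
  · exact absurd hi.symm hp.one_lt.ne'
  · tauto

/-- A tuple of divisors of `p` with product `p^j` is `p^{𝟙_S}` with `|S| = j`. -/
theorem eq_dS_of_dvd {p : ℕ} (hp : p.Prime) {j : ℕ} {d : Fin k → ℕ} (hd : d ∈ Nat.finMulAntidiag k (p ^ j))
    (hdp : ∀ i, d i ∣ p) : ∃ S : Finset (Fin k), S.card = j ∧ d = dS p S := by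
  classical
  set S := Finset.univ.filter (fun i => d i = p) with hS
  have hdS : d = dS p S := by
    funext i
    simp only [dS_apply, hS, Finset.mem_filter, Finset.mem_univ, true_and]
    split_ifs with h
    · exact h
    · rcases (Nat.dvd_prime hp).mp (hdp i) with h1 | h1
      · exact h1
      · exact absurd h1 h
  refine ⟨S, ?_, hdS⟩
  have hprod := Nat.prod_eq_of_mem_finMulAntidiag hd
  rw [hdS, prod_dS] at hprod
  exact Nat.pow_right_injective hp.two_le hprod

/-- **Square-free reduction of `∑_j ∑_{∏ d = p^j}`**: for a weight vanishing on tuples with a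
coordinate `p^v`, `v ≥ 2`: `∑_{j ≤ k} ∑_{∏ d = p^j} w(d) = ∑_{S} w(p^{𝟙_S})`. -/
theorem sum_range_sum_finMulAntidiag_eq_sum_powerset {M : Type*} [AddCommMonoid M] {p : ℕ}
    (hp : p.Prime) (w : (Fin k → ℕ) → M)
    (hw : ∀ (d : Fin k → ℕ) (v : Fin k → ℕ), (∀ i, d i = p ^ v i) → ∀ i, 2 ≤ v i → w d = 0) :
    ∑ j ∈ Finset.range (k + 1), ∑ d ∈ Nat.finMulAntidiag k (p ^ j), w d =
      ∑ S : Finset (Fin k), w (dS p S) := by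
  classical
  -- reduce each inner sum to the square-free tuples, i.e. to `image dS (powersetCard j)`
  have hinner : ∀ j : ℕ, ∑ d ∈ Nat.finMulAntidiag k (p ^ j), w d =
      ∑ S ∈ Finset.powersetCard j (Finset.univ : Finset (Fin k)), w (dS p S) := by
    intro j
    rw [← Finset.sum_filter_of_ne (p := fun d => ∀ i, d i ∣ p) (fun d hd hne => ?_)]
    · rw [← Finset.sum_image (f := w) (s := Finset.powersetCard j Finset.univ) (g := dS p)
        (fun S _ T _ h => dS_injective hp h)]
      refine Finset.sum_congr ?_ fun _ _ => rfl
      ext d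
      simp only [Finset.mem_filter, Finset.mem_image, Finset.mem_powersetCard, Finset.subset_univ,
        true_and]
      constructor
      · rintro ⟨hd, hdp⟩
        obtain ⟨S, hS, rfl⟩ := eq_dS_of_dvd hp hd hdp
        exact ⟨S, hS, rfl⟩
      · rintro ⟨S, hS, rfl⟩
        refine ⟨hS ▸ dS_mem_finMulAntidiag hp S, fun i => ?_⟩
        rw [dS_apply]; split_ifs
        · exact dvd_refl p
        · exact one_dvd p
    · -- a non-square-free tuple has zero weight
      by_contra hdiv
      apply hne
      obtain ⟨v, hdv, -, -⟩ := exists_pow_eq_of_mem_finMulAntidiag hp hd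
      push Not at hdiv
      obtain ⟨i, hi⟩ := hdiv
      refine hw d v hdv i ?_
      by_contra hlt
      apply hi
      rw [hdv i]
      interval_cases (v i) <;> simp
  simp_rw [hinner]
  rw [← Finset.powerset_univ, Finset.powerset_card_disjiUnion, Finset.sum_disjiUnion, Finset.card_univ,
    Fintype.card_fin]

/-! ### `G(p^{𝟙_S})` and inclusion–exclusion -/

/-- `G(p^{𝟙_S}) = #{n < p : p ∣ f_i(n) ∀ i ∈ S}/p`. -/
theorem sysDensity_dS {p : ℕ} (hp : p.Prime) (S : Finset (Fin k)) :
    sysDensity f (dS p S) =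
      (((Finset.range p).filter fun n : ℕ => ∀ i ∈ S, ((p : ℕ) : ℤ) ∣ (f i).eval (n : ℤ)).card : ℝ) / p := by
  classical
  have hp0 : (0 : ℝ) < p := by exact_mod_cast hp.pos
  rcases S.eq_empty_or_nonempty with rfl | hS
  · have h1 : dS p (∅ : Finset (Fin k)) = fun _ => 1 := by funext i; simp [dS_apply]
    rw [h1, sysDensity_one]
    have : (Finset.range p).filter (fun n : ℕ => ∀ i ∈ (∅ : Finset (Fin k)),
        ((p : ℕ) : ℤ) ∣ (f i).eval (n : ℤ)) = Finset.range p :=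
      Finset.filter_true_of_mem fun n _ i hi => absurd hi (Finset.notMem_empty i)
    rw [this, Finset.card_range, div_self hp0.ne']
  -- `S ≠ ∅`: `lcm = p` and the conditions for `i ∉ S` are void
  have hlcm : tupleLcm (dS p S) = p := by
    obtain ⟨i₀, hi₀⟩ := hS
    refine Nat.dvd_antisymm (Finset.lcm_dvd fun i _ => ?_) ?_
    · rw [dS_apply]; split_ifs
      · exact dvd_refl p
      · exact one_dvd p
    · have := dvd_tupleLcm (dS p S) i₀
      rwa [dS_apply, if_pos hi₀] at this
  have hsols : sysSols f (dS p S) (Finset.range p) =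
      (Finset.range p).filter (fun n : ℕ => ∀ i ∈ S, ((p : ℕ) : ℤ) ∣ (f i).eval (n : ℤ)) := by
    ext n
    rw [mem_sysSols, Finset.mem_filter]
    refine and_congr_right fun _ => ⟨fun h i hi => ?_, fun h i => ?_⟩
    · have := h i; rwa [dS_apply, if_pos hi] at this
    · rw [dS_apply]; split_ifs with hi
      · exact h i hi
      · simp
  unfold sysDensity sysCount
  rw [hlcm, hsols]

/-- **`∑_{j ≤ k} 𝒶₀(p^j) = 1 − ω(p)/p`.** -/
theorem sum_proj0_aFun_prime_pow {p : ℕ} (hp : p.Prime) :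
    ∑ j ∈ Finset.range (k + 1), proj0 (aFun f) (p ^ j) = 1 - (polyRootCountMod f p : ℝ) / p := by
  classical
  have hp0 : (0 : ℝ) < p := by exact_mod_cast hp.pos
  simp_rw [proj0_apply, coeff_empty_aFun]
  rw [sum_range_sum_finMulAntidiag_eq_sum_powerset hp _ (fun d v hdv i hi => by
    rw [Finset.prod_eq_zero (Finset.mem_univ i) (by
      rw [hdv i, ArithmeticFunction.moebius_apply_prime_pow hp (by omega), if_neg (by omega)]; simp),
      mul_zero])]
  -- `∏ μ(dS i) = (-1)^{|S|}`
  have hmu : ∀ S : Finset (Fin k), ∏ i, (μ (dS p S i) : ℝ) = (-1) ^ S.card := by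
    intro S
    simp only [dS_apply]
    rw [show (∏ i, ((μ (if i ∈ S then p else 1) : ℤ) : ℝ)) = ∏ i, (if i ∈ S then (-1 : ℝ) else 1) from
      Finset.prod_congr rfl fun i _ => by
        split_ifs
        · rw [ArithmeticFunction.moebius_apply_prime hp]; norm_num
        · rw [ArithmeticFunction.moebius_apply_one]; norm_num,
      Finset.prod_ite, Finset.prod_const_one, mul_one, Finset.prod_const, Finset.filter_mem_eq_inter,
      Finset.univ_inter]
  simp_rw [hmu, sysDensity_dS f hp]
  -- swap the sums: `∑_S (-1)^{|S|} #{n : …} = ∑_{n < p} ∑_{S ⊆ Z(n)} (-1)^{|S|}`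
  set Z : ℕ → Finset (Fin k) := fun n => Finset.univ.filter fun i => ((p : ℕ) : ℤ) ∣ (f i).eval (n : ℤ)
    with hZ
  have hfil : ∀ n : ℕ, (Finset.univ : Finset (Finset (Fin k))).filter
      (fun S => ∀ i ∈ S, ((p : ℕ) : ℤ) ∣ (f i).eval (n : ℤ)) = (Z n).powerset := by
    intro n
    ext S
    simp only [Finset.mem_filter, Finset.mem_univ, true_and, Finset.mem_powerset, hZ]
    constructor
    · intro h i hi; exact Finset.mem_filter.mpr ⟨Finset.mem_univ i, h i hi⟩
    · intro h i hi; exact (Finset.mem_filter.mp (h hi)).2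
  have hswap : ∑ S : Finset (Fin k),
      (((Finset.range p).filter fun n : ℕ => ∀ i ∈ S, ((p : ℕ) : ℤ) ∣ (f i).eval (n : ℤ)).card : ℝ) / p *
        (-1) ^ S.card =
      (1 / (p : ℝ)) * ∑ n ∈ Finset.range p, ∑ S ∈ (Z n).powerset, (-1 : ℝ) ^ S.card := by
    calc ∑ S : Finset (Fin k), (((Finset.range p).filter fun n : ℕ =>
          ∀ i ∈ S, ((p : ℕ) : ℤ) ∣ (f i).eval (n : ℤ)).card : ℝ) / p * (-1) ^ S.card
        = ∑ S : Finset (Fin k), ∑ n ∈ Finset.range p,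
            (1 / (p : ℝ)) * (if ∀ i ∈ S, ((p : ℕ) : ℤ) ∣ (f i).eval (n : ℤ) then (-1 : ℝ) ^ S.card else 0) := by
          refine Finset.sum_congr rfl fun S _ => ?_
          rw [Finset.card_filter]
          push_cast
          rw [Finset.sum_div, Finset.sum_mul]
          refine Finset.sum_congr rfl fun n _ => ?_
          split_ifs <;> ring
      _ = (1 / (p : ℝ)) * ∑ n ∈ Finset.range p, ∑ S : Finset (Fin k),
            (if ∀ i ∈ S, ((p : ℕ) : ℤ) ∣ (f i).eval (n : ℤ) then (-1 : ℝ) ^ S.card else 0) := by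
          rw [Finset.sum_comm, Finset.mul_sum]
          exact Finset.sum_congr rfl fun n _ => (Finset.mul_sum _ _ _).symm
      _ = (1 / (p : ℝ)) * ∑ n ∈ Finset.range p, ∑ S ∈ (Z n).powerset, (-1 : ℝ) ^ S.card := by
          congr 1
          refine Finset.sum_congr rfl fun n _ => ?_
          rw [← Finset.sum_filter, hfil n]
  rw [hswap]
  have hIE : ∀ x : Finset (Fin k), ∑ S ∈ x.powerset, (-1 : ℝ) ^ S.card = if x = ∅ then 1 else 0 := by
    intro x
    have := Finset.sum_powerset_neg_one_pow_card (x := x)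
    exact_mod_cast this
  simp_rw [hIE]
  rw [Finset.sum_ite, Finset.sum_const_zero, add_zero, Finset.sum_const, nsmul_eq_mul, mul_one]
  -- `#{n < p : Z(n) = ∅} = p − ω(p)`
  have hprime : Prime ((p : ℕ) : ℤ) := Nat.prime_iff_prime_int.mp hp
  have hcard : ((Finset.range p).filter fun n => Z n = ∅).card + polyRootCountMod f p = p := by
    unfold polyRootCountMod
    have hcompl : (Finset.range p).filter (fun n => Z n = ∅) =
        (Finset.range p).filter (fun n : ℕ => ¬((p : ℤ) ∣ ∏ i, (f i).eval (n : ℤ))) := by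
      refine Finset.filter_congr fun n _ => ?_
      rw [hprime.dvd_finsetProd_iff]
      simp only [hZ, Finset.filter_eq_empty_iff, Finset.mem_univ, true_imp_iff, not_exists, not_and]
    rw [hcompl, Finset.filter_not, Finset.card_sdiff_of_subset (Finset.filter_subset _ _),
      Finset.card_range]
    exact Nat.sub_add_cancel ((Finset.card_filter_le _ _).trans (Finset.card_range p).le)
  have hcard' : (((Finset.range p).filter fun n => Z n = ∅).card : ℝ) = p - polyRootCountMod f p := by
    have := congrArg (fun m : ℕ => (m : ℝ)) hcard
    push_cast at this
    linarith
  rw [hcard']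
  field_simp

end Summit.Parity.BatemanHorn.Theorems.TypeIMainTerm

end
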